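import Literature.MathematicalPhysics.QuantumFieldTheory.Balaban1983to89.B9Eq3126EnergyBallTowerPiClosed
import Literature.MathematicalPhysics.QuantumFieldTheory.Balaban1983to89.B11Eq117LetterDefects

/-!
# `Balaban1983to89.B11Eq117LetterDefectsTowerPiDiagonal` — T. Bałaban, *The variational problem and background fields in renormalization group method for
# lattice gauge theories*, Commun. Math. Phys. **102** (1985) 277–309 [Balaban1985Variational] (117) p. 295, (120) p. 296, (174) p. 308 with (103) p. 293,
# (110)–(111) p. 294, (115) p. 294, and T. Bałaban, *Propagators for lattice gauge theories in a background field*, Commun. Math. Phys. **99** (1985) 389–434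
# [Balaban1985BackgroundPropagators] (3.122) ∕ (3.126) p. 420, (3.153) p. 426, Thm 3.4 p. 400, Thm 3.13 p. 426: **THE `k`-LEVEL LETTER DEFECTS `K_ι`, `δ_G̃`,
# `δ_Ã` ON THE DIAGONAL FOR PRINT's OWN LETTERS, (117) ISOLATED** — the three inputs of `B11Eq120SolutionContinuity` ∕ `B11Eq174ChartContinuityAtFlat` for the
# `k`-th-step letters of print's operator (3.122) (`B9Eq3119DeltaPiTower.laplaceAkPi`, NAMED), = LEVEL-FREE constant × (117)'s EXPLICIT product × `α` (the
# owner's `B11Eq117LetterDefectsTowerDiagonal` (gen 87) for print's letters; the π-junction read through `B11Eq117LetterDefects` §1–§3)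

statement-level skeleton of published theorems with citation tags; proofs where landed; nothing here is a claim about the Yang–Mills mass gap

CITATION HEADER (lean-in-tree rule).  Audit cell `pub-balaban`, sub-cell `t4`, BINDER row NE9; filed by the row OWNER lineage `b2b-balaban-t4-ne9-p1`
(gen 88; plan v8 «the K̃-floor transfer + the π-junction», the chart-continuity reading of the π-junction).  Sources READ by this lineage in the held texts:
[Balaban1985Variational] pp. 285, 293–297, 308 (`paper:balaban1985-cmp102-variational-background`, journal page = PDF page + 276);
[Balaban1985BackgroundPropagators] pp. 400, 416, 419–421, 425–426 (`paper:balaban1985-cmp99-background-propagators`, journal page = PDF page + 388).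

THE PRINT (verbatim).  [Balaban1985Variational] p. 295 L7–L9: *«By Theorem 3.13 of [5] the norm max{| |_(−1), |∇ |_(−2)} of the transformation can be
estimated by [(117)] if ε₄ + B₀|B| ≤ a₃»*; p. 296 (120): *«The solution … is an analytic function of (U, B) …»*; [Balaban1985BackgroundPropagators] p. 400,
Thm 3.4: *«… describing these analytic extensions as small perturbations of the operators depending on U only»*; p. 420 (3.126): *«H B = G̃Q*(QG̃Q*)⁻¹B»*.

WHY THIS FILE (cell context; DIAGNOSIS D-ne9p1-g87-1).  `B11Eq117LetterDefectsTowerDiagonal` (gen 87) reads the CHAIN's flat-point Lipschitz rows (print's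
`G₀`-slot letters) through `B11Eq117LetterDefects` §1–§3 into the three letter defects `K_ι`, `δ_G`, `δ_A` that `B11Eq120SolutionContinuity` ∕
`B11Eq174ChartContinuityAtFlat` ∕ `Support/NE9CurChartLipschitzAtFlat` consume.  The π-junction `B9Eq3126EnergyBallTowerPiClosed` (gen 88) supplies the SAME
rows for print's letters `𝔊̃_k(U)`, `H̃_k(U)` of (3.122)∕(3.126)∕(3.153) against the flat reference letters (the chain's at `U ≡ 1` = print's there,
ne9-leaf-03's `B9Eq3119DeltaPiTowerFlat.letters_laplaceAkPi_one`).  THIS file is the gen-87 reading VERBATIM for those rows: the chart of the `k`-th-step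
`cur U` species AT PRINT's OPERATOR is Lipschitz in the background at the flat point modulo (117)'s ONE displayed product — nothing else.

WHAT IS PROVED (sorry-free; 0 `def`; [folklore] composition BY NAME).
* **`exists_letter_defects_tower_pi_diagonal_closed`** — `∃ α₀ K > 0` (`K` = the π-junction's `C`, closed in `(d, a, a′, L, M_φ, M_φ′, r, C_τ, ρ_w)`) before
  every binder (as `B11Eq117LetterDefectsTowerDiagonal` plus the averaged-bond membership `Ū^j(b) ∈ U1`, the site witness `hpos′` and print's witness `hpos₁`
  in place of the chain's `hposU`); then (K_ι) `‖ι_{∇_U→∇_1} f‖ ≤ (1 + w̄₁·(2|η|⁻¹·αη)·w̲₀⁻¹)‖f‖` (unchanged — a property of `∇_U` alone), (δ_G̃)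
  `‖ι(𝔊̃_k(U)f) − 𝔊_k(1)f‖_(115),∇_1 ≤ K·V_G·α·|f|_(−3)`, (δ_Ã) `‖ι(H̃_k(U)B) − H_k(1)B‖_(115),∇_1 ≤ K·V_H·α·|B|_(−0)`, `V_G`, `V_H` (117)'s explicit products.
  MECHANISM: the π-junction's `[𝔊̃]`∕`[H̃]` Lipschitz rows (one `obtain`) through `B11Eq117LetterDefects.norm_jetId_le` ∕ `norm_toCLM115_readFun_sub_le` ∕
  `norm_H1CLM_sub_le` ∕ `jetId_frakG_eq_toCLM115_readFun` ∕ `frakG_eq_toCLM115_readFun`, exactly as the gen-87 file.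
HONEST SCOPE.  [folklore]; FIRST order at the flat point; the (117) factors ARE load-bearing (NOT print's lattice-uniform `B₀` — Thm 3.13's decay is not in
the tree); windows, E162 data, unitarity + trace letters, `ρ_w`, averaged-bond membership, the witnesses HYPOTHESES; the k-level (Z) assembly
(`Support/NE9CurChartLipschitzAtFlat` one storey up, at `laplaceAkPi`) is NOT here (Support = INTERFACE REQUEST only).  NOT summit progress (cell pub-balaban:
NE9 NOT PRINTED ∕ NOT PROVED; «NE9 ⇐ the named binders»; row WALLED ON A MODEL (O-NE9-1; #5 UNRULED); spine PROVED 0∕9; rung (B)+1 finite T⁴ — NOT infinite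
volume, NOT mass gap, NOT BetaPertH, NOT Clay).  HONEST DEPENDENCY (cell line): continuum YM on T⁴ ⇐ BetaPertH ∧ nine spine estimates (0/9 proved); BetaPertH ⇐
(D1) ∧ (D4) ∧ CAP+tail; G-an2-4 gates asym, D1 and NE2/3/4.  NEW file; nothing modified.  Net new unproved facts: 0.
-/

noncomputable section

open scoped InnerProductSpace ComplexConjugate BigOperators

namespace Literature.MathematicalPhysics.QuantumFieldTheory.Balaban1983to89.B11Eq117LetterDefectsTowerPiDiagonal

open B4Sect5Torus (TSite)
open B9SectCLatticeCarrier (Bond)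
open B11Eq103H1Complex (SiteL2K BondL2K covDerivL2K covDivL2K laplaceALatticeK greenK G1LatticeK H1LatticeK frakGLatticeK KinvLatticeK
  H1LatticeCLM frakGLatticeCLM H1CLM readFun)
open B11Eq115Space (NegSize Space115 levWeight NegSup)
open B11Eq111FrakG (nabla115 jetLinearEquiv toCLM115)
open B11Eq117TransformationNorm (norm_nabla115_le)
open B11Eq117LetterDefects (norm_jetId_le norm_nabla115_sub_flat_le norm_toCLM115_readFun_sub_le norm_H1CLM_sub_le
  jetId_frakG_eq_toCLM115_readFun frakG_eq_toCLM115_readFun)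
open B9Eq310HessianOperator (adTransportW hessOp covCurlL2K)
open B9Eq310DeltaPrime (plaqHolU)
open B9Eq315QTorus (perCfg cornerSite)
open B9Eq315QTower (towerP UlevOf)
open B9Eq315QTowerFlat (perCfg_UlevOf_one_mem_U1 norm_Wcx_UlevOf_one_sub_one_le)
open B9Eq326OperatorTower (laplaceAk QkW RofUk)
open B7Prop1Explicit (U1 Wcx boxVec)
open B9Eq3126EnergyBallTowerPiClosed (exists_energy_ball_pi_diagonal_closed)
open B9Eq324DeltaPrimeATower (laplacePrimeAk GpOfUk)
open B9Eq3119DeltaPiTower (piOfUk laplaceAkPi)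

variable {d : ℕ} (hd : 1 ≤ d) (L : ℕ) [NeZero L] (hL : 1 ≤ L)
  {𝔸 : Type*} [NormedRing 𝔸] [NormedAlgebra ℂ 𝔸] [CompleteSpace 𝔸] [NormOneClass 𝔸] [StarRing 𝔸] [NormedStarGroup 𝔸] [StarModule ℂ 𝔸]
  [FiniteDimensional ℂ 𝔸]
  {W : Type*} [NormedAddCommGroup W] [InnerProductSpace ℂ W] [FiniteDimensional ℂ W] (φ : W ≃ₗ[ℂ] 𝔸)
  {Mφ Mφ' : ℝ} (hMφ : 0 ≤ Mφ) (hMφ' : 0 ≤ Mφ') (hφ : ∀ w, ‖φ w‖ ≤ Mφ * ‖w‖) (hφ' : ∀ X, ‖φ.symm X‖ ≤ Mφ' * ‖X‖)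
  {a : ℝ} (ha : 0 < a) {a' : ℝ} (ha' : 0 < a') {r : ℝ} (hr0 : 0 ≤ r) (hr1 : r < 1)
  (τ : 𝔸 →ₗ[ℂ] ℂ) {Cτ : ℝ} (hτ : ∀ X, ‖τ X‖ ≤ Cτ * ‖X‖) (hCτ : 0 ≤ Cτ) {ρw : ℝ} (hρw : 0 ≤ ρw)
  (hτ₁ : ∀ X : 𝔸, τ (star X) = conj (τ X)) (hτ₂ : ∀ X Y : 𝔸, τ (X * Y) = τ (Y * X))
  (hφτ : ∀ X Y : 𝔸, ⟪φ.symm X, φ.symm Y⟫_ℂ = τ (star X * Y))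

include hd hMφ hMφ' hφ hφ' ha ha' hr0 hr1 hτ hCτ hρw hτ₁ hτ₂ hφτ

set_option maxHeartbeats 800000 in
set_option maxRecDepth 8192 in
/-- **THE `k`-LEVEL LETTER DEFECTS AT THE FLAT POINT ON THE DIAGONAL FOR PRINT's LETTERS, (117)'s FACTOR ISOLATED** — see the module header: `∃ α₀ K > 0`
(`K` level-free) before every binder; then for unitary `U` in the three windows, averaged bonds in `U1`, ANY level maps and ANY witnesses `hpos′ hpos₁ hpos1
hQU hQ1`: (K_ι) the jet identity `∇_U → ∇_1` is bounded by `1 + w̄₁·(2|η|⁻¹·αη)·w̲₀⁻¹`; (δ_G̃) `‖ι(𝔊̃_k(U)f) − 𝔊_k(1)f‖ ≤ K·V_G·α·‖f‖`; (δ_Ã)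
`‖ι(H̃_k(U)B) − H_k(1)B‖ ≤ K·V_H·α·‖B‖` for print's `𝔊̃_k`, `H̃_k` of (3.153)∕(3.126) on `G̃` of (3.122), the (117) products `V_G`, `V_H` displayed.  The
π-junction read through `B11Eq117LetterDefects` §1–§3. [folklore]
[cite: Balaban1985Variational, (103) p.293, (110)–(111) p.294, (115) p.294, (117) p.295, (174) p.305; Balaban1985BackgroundPropagators, (3.3) p.391, Thm 3.4 p.400, (3.126) p.420, (3.153) p.426] -/
theorem exists_letter_defects_tower_pi_diagonal_closed [Fact (0 < (L : ℝ))] :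
    ∃ α₀ K : ℝ, 0 < α₀ ∧ 0 < K ∧ ∀ (n : ℕ) (η : ℝ) [Fact (0 < η)], η * (L : ℝ) ^ (n + 1) = 1 → 3 ≤ L ^ (n + 1) →
      ∀ (c₀ c₁ : ℝ) [Fact (0 < c₀)] [Fact (0 < c₁)], c₀ * ((L : ℝ) ^ (n + 1)) ^ d = c₁ → |η| ^ d / c₀ ≤ ρw →
      ∀ (m : Fin d → ℕ) [∀ i, NeZero (m i)] (lev₀ : Bond d (towerP L m (n + 1)) → ℕ) (levB : Bond d m → ℕ)
        (lev₁ : Bond d (towerP L m (n + 1)) × Fin d → ℕ)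
        (U : Bond d (towerP L m (n + 1)) → 𝔸ˣ) (αU : ℕ → ℝ) (hα1 : ∀ j, αU j ≤ 1 / 64)
        (hU1 : ∀ (j : ℕ) (x : B7Prop1Explicit.Site d) (κ : Fin d), perCfg (towerP L m (j + 1)) (UlevOf L m (n + 1) U j) x κ ∈ U1 𝔸)
        (hreg : ∀ (j : ℕ) (y : TSite d (towerP L m j)) (κ : Fin d) (r : Fin d → Fin L),
          ‖((Wcx L (perCfg (towerP L m (j + 1)) (UlevOf L m (n + 1) U j)) (cornerSite L y) κ (boxVec L r) : 𝔸ˣ) : 𝔸) - 1‖ ≤ αU j)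
        (εU : ℕ → ℝ), (∀ j, 0 ≤ εU j) → (∀ (j : ℕ) (b : Bond d (towerP L m (j + 1))), ‖(UlevOf L m (n + 1) U j b : 𝔸) - 1‖ ≤ εU j) →
      ∀ {α : ℝ}, 0 ≤ α → α ≤ α₀ →
        (∀ b, star (U b : 𝔸) = (((U b)⁻¹ : 𝔸ˣ) : 𝔸)) →
        (∀ b, U b ∈ U1 𝔸) → (∀ b, ‖(U b : 𝔸) - 1‖ ≤ α * η) →
        (∀ p : B9SectCLatticeCarrier.Plaq d (towerP L m (n + 1)), ‖(plaqHolU U p : 𝔸) - 1‖ ≤ α * η ^ 2) →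
        (∀ j < n + 1, εU j ≤ α * r ^ j) →
        (∀ (j : ℕ) (b : Bond d (towerP L m (j + 1))), UlevOf L m (n + 1) U j b ∈ U1 𝔸) →
        ∀ (hpos' : ∀ x : SiteL2K ℂ d (towerP L m (n + 1)) c₀ W, x ≠ 0 → 0 < RCLike.re ⟪x, laplacePrimeAk L m n φ η U a' (c₁ := c₁) x⟫_ℂ)
          (hpos₁ : ∀ x : BondL2K ℂ d (towerP L m (n + 1)) c₀ W, x ≠ 0 →
            0 < RCLike.re ⟪x, laplaceAkPi L m n φ τ η U a' hpos' hL αU hα1 hU1 hreg (c₁ := c₁) a x⟫_ℂ)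
          (hpos1 : ∀ x : BondL2K ℂ d (towerP L m (n + 1)) c₀ W, x ≠ 0 →
            0 < RCLike.re ⟪x, laplaceAk L m n φ η (fun _ : Bond d (towerP L m (n + 1)) => (1 : 𝔸ˣ)) hL (fun _ => 0) (fun _ => by norm_num)
              (perCfg_UlevOf_one_mem_U1 L m (n + 1)) (norm_Wcx_UlevOf_one_sub_one_le L m (n + 1) (fun _ => 0) (fun _ => le_rfl)) τ
              (c₀ := c₀) (c₁ := c₁) a x⟫_ℂ)
          (hQU : Function.Surjective (QkW L m n φ U hL αU hα1 hU1 hreg (c₀ := c₀) (c₁ := c₁)))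
          (hQ1 : Function.Surjective (QkW L m n φ (fun _ : Bond d (towerP L m (n + 1)) => (1 : 𝔸ˣ)) hL (fun _ => 0) (fun _ => by norm_num)
            (perCfg_UlevOf_one_mem_U1 L m (n + 1)) (norm_Wcx_UlevOf_one_sub_one_le L m (n + 1) (fun _ => 0) (fun _ => le_rfl)) (c₀ := c₀) (c₁ := c₁))),
        -- (K_ι) the jet identity `∇_U → ∇_1`
        (∀ f : Space115 (L : ℝ) η lev₀ lev₁ (nabla115 η U),
          ‖LinearMap.toContinuousLinearMap
              ((jetLinearEquiv (L : ℝ) η lev₀ lev₁ (nabla115 η (fun _ : Bond d (towerP L m (n + 1)) => (1 : 𝔸ˣ)))).symm.toLinearMap ∘ₗ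
                (jetLinearEquiv (L : ℝ) η lev₀ lev₁ (nabla115 η U)).toLinearMap) f‖ ≤
            (1 + (NegSup.wSup (levWeight (L : ℝ) η lev₁ 2) : ℝ) * (2 * ‖((η : ℂ))⁻¹‖ * (α * η)) * NegSup.wInvSup (levWeight (L : ℝ) η lev₀ 1)) * ‖f‖) ∧
        -- (δ_G) the `𝔊`-letter across the two norms
        (∀ f : NegSize (L : ℝ) η lev₀ 3 𝔸,
          ‖LinearMap.toContinuousLinearMap
              ((jetLinearEquiv (L : ℝ) η lev₀ lev₁ (nabla115 η (fun _ : Bond d (towerP L m (n + 1)) => (1 : 𝔸ˣ)))).symm.toLinearMap ∘ₗ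
                (jetLinearEquiv (L : ℝ) η lev₀ lev₁ (nabla115 η U)).toLinearMap)
              (frakGLatticeCLM (L := (L : ℝ)) (η := η) (lev₀ := lev₀) φ hpos₁ hQU lev₁ (nabla115 η U) f) -
            frakGLatticeCLM (L := (L : ℝ)) (η := η) (lev₀ := lev₀) (c := ((η : ℂ))⁻¹) (R := adTransportW φ (fun _ : Bond d (towerP L m (n + 1)) => (1 : 𝔸ˣ)))
              (S := adTransportW φ fun _ : Bond d (towerP L m (n + 1)) => (1 : 𝔸ˣ)⁻¹) (Δ₁ := hessOp φ η (fun _ : Bond d (towerP L m (n + 1)) => (1 : 𝔸ˣ)) τ)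
              (Rr := RofUk L m n φ η (fun _ : Bond d (towerP L m (n + 1)) => (1 : 𝔸ˣ)))
              (Q := (QkW L m n φ (fun _ : Bond d (towerP L m (n + 1)) => (1 : 𝔸ˣ)) hL (fun _ => 0) (fun _ => by norm_num)
                (perCfg_UlevOf_one_mem_U1 L m (n + 1)) (norm_Wcx_UlevOf_one_sub_one_le L m (n + 1) (fun _ => 0) (fun _ => le_rfl)) (c₀ := c₀) (c₁ := c₁)))
              (a := a) φ hpos1 hQ1 lev₁ (nabla115 η fun _ : Bond d (towerP L m (n + 1)) => (1 : 𝔸ˣ)) f‖ ≤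
            K * (max (NegSup.wSup (levWeight (L : ℝ) η lev₀ 1) : ℝ) (NegSup.wSup (levWeight (L : ℝ) η lev₁ 2) * (2 * ‖((η : ℂ))⁻¹‖)) *
              (Mφ * Real.sqrt (c₀ * Fintype.card (Bond d (towerP L m (n + 1)))) * Mφ' / Real.sqrt c₀) *
              NegSup.wInvSup (levWeight (L : ℝ) η lev₀ 3)) * α * ‖f‖) ∧
        -- (δ_A) the `H₁`-letter across the two norms
        (∀ B : NegSize (L : ℝ) η levB 0 𝔸,
          ‖LinearMap.toContinuousLinearMap
              ((jetLinearEquiv (L : ℝ) η lev₀ lev₁ (nabla115 η (fun _ : Bond d (towerP L m (n + 1)) => (1 : 𝔸ˣ)))).symm.toLinearMap ∘ₗ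
                (jetLinearEquiv (L : ℝ) η lev₀ lev₁ (nabla115 η U)).toLinearMap)
              (H1LatticeCLM (L := (L : ℝ)) (η := η) (lev₀ := lev₀) (levB := levB) φ hpos₁ hQU lev₁ (nabla115 η U) B) -
            H1LatticeCLM (L := (L : ℝ)) (η := η) (lev₀ := lev₀) (levB := levB) (c := ((η : ℂ))⁻¹)
              (R := adTransportW φ (fun _ : Bond d (towerP L m (n + 1)) => (1 : 𝔸ˣ)))
              (S := adTransportW φ fun _ : Bond d (towerP L m (n + 1)) => (1 : 𝔸ˣ)⁻¹) (Δ₁ := hessOp φ η (fun _ : Bond d (towerP L m (n + 1)) => (1 : 𝔸ˣ)) τ)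
              (Rr := RofUk L m n φ η (fun _ : Bond d (towerP L m (n + 1)) => (1 : 𝔸ˣ)))
              (Q := (QkW L m n φ (fun _ : Bond d (towerP L m (n + 1)) => (1 : 𝔸ˣ)) hL (fun _ => 0) (fun _ => by norm_num)
                (perCfg_UlevOf_one_mem_U1 L m (n + 1)) (norm_Wcx_UlevOf_one_sub_one_le L m (n + 1) (fun _ => 0) (fun _ => le_rfl)) (c₀ := c₀) (c₁ := c₁)))
              (a := a) φ hpos1 hQ1 lev₁ (nabla115 η fun _ : Bond d (towerP L m (n + 1)) => (1 : 𝔸ˣ)) B‖ ≤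
            K * (max (NegSup.wSup (levWeight (L : ℝ) η lev₀ 1) : ℝ) (NegSup.wSup (levWeight (L : ℝ) η lev₁ 2) * (2 * ‖((η : ℂ))⁻¹‖)) *
              (Mφ * Real.sqrt (c₁ * Fintype.card (Bond d m)) * Mφ' / Real.sqrt c₀) *
              NegSup.wInvSup (levWeight (L : ℝ) η levB 0)) * α * ‖B‖) := by
  obtain ⟨α₀, C, hα₀, hC, H⟩ := exists_energy_ball_pi_diagonal_closed hd L hL φ hMφ hMφ' hφ hφ' ha ha' hr0 hr1 τ hτ hCτ hρw hτ₁ hτ₂ hφτ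
  refine ⟨α₀, C, hα₀, hC, ?_⟩
  intro n η _ hηL hL3 c₀ c₁ _ _ hw hρ m _ lev₀ levB lev₁ U αU hα1 hU1 hreg εU hεU hUε α hα0 hαle hUst hUb hUη hpl hεg hUlev hpos' hpos₁ hpos1 hQU hQ1
  obtain ⟨-, -, HF, HH⟩ := H n η hηL hL3 c₀ c₁ hw hρ m U αU hα1 hU1 hreg εU hεU hUε hα0 hαle hUst hUb hUη hpl hεg hUlev hpos' hpos₁ hpos1 hQU hQ1
  -- the mass rows of the two Lipschitz groups
  have hG : ∀ x : BondL2K ℂ d (towerP L m (n + 1)) c₀ W, ‖frakGLatticeK hpos₁ hQU x - frakGLatticeK (c := ((η : ℂ))⁻¹)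
        (R := adTransportW φ (fun _ : Bond d (towerP L m (n + 1)) => (1 : 𝔸ˣ))) (S := adTransportW φ fun _ : Bond d (towerP L m (n + 1)) => (1 : 𝔸ˣ)⁻¹)
        (Δ₁ := hessOp φ η (fun _ : Bond d (towerP L m (n + 1)) => (1 : 𝔸ˣ)) τ) (Rr := RofUk L m n φ η (fun _ : Bond d (towerP L m (n + 1)) => (1 : 𝔸ˣ)))
        (Q := (QkW L m n φ (fun _ : Bond d (towerP L m (n + 1)) => (1 : 𝔸ˣ)) hL (fun _ => 0) (fun _ => by norm_num)
          (perCfg_UlevOf_one_mem_U1 L m (n + 1)) (norm_Wcx_UlevOf_one_sub_one_le L m (n + 1) (fun _ => 0) (fun _ => le_rfl)) (c₀ := c₀) (c₁ := c₁)))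
        (a := a) hpos1 hQ1 x‖ ≤ (C * α) * ‖x‖ := fun x => by rw [mul_assoc]; exact ((HF x).2.2.2.1).trans_eq (by ring)
  have hH : ∀ b : BondL2K ℂ d m c₁ W, ‖H1LatticeK hpos₁ hQU b - H1LatticeK (c := ((η : ℂ))⁻¹)
        (R := adTransportW φ (fun _ : Bond d (towerP L m (n + 1)) => (1 : 𝔸ˣ))) (S := adTransportW φ fun _ : Bond d (towerP L m (n + 1)) => (1 : 𝔸ˣ)⁻¹)
        (Δ₁ := hessOp φ η (fun _ : Bond d (towerP L m (n + 1)) => (1 : 𝔸ˣ)) τ) (Rr := RofUk L m n φ η (fun _ : Bond d (towerP L m (n + 1)) => (1 : 𝔸ˣ)))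
        (Q := (QkW L m n φ (fun _ : Bond d (towerP L m (n + 1)) => (1 : 𝔸ˣ)) hL (fun _ => 0) (fun _ => by norm_num)
          (perCfg_UlevOf_one_mem_U1 L m (n + 1)) (norm_Wcx_UlevOf_one_sub_one_le L m (n + 1) (fun _ => 0) (fun _ => le_rfl)) (c₀ := c₀) (c₁ := c₁)))
        (a := a) hpos1 hQ1 b‖ ≤ (C * α) * ‖b‖ := fun b => by rw [mul_assoc]; exact ((HH b).2.2.2.1).trans_eq (by ring)
  have hCα : 0 ≤ C * α := mul_nonneg hC.le hα0
  have hαη : 0 ≤ α * η := mul_nonneg hα0 (le_of_lt (Fact.out : 0 < η))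
  -- the flat derivative letter and the defect of the derivative letters
  have h1b : ∀ b : Bond d (towerP L m (n + 1)), ‖(((fun _ : Bond d (towerP L m (n + 1)) => (1 : 𝔸ˣ)) b : 𝔸ˣ) : 𝔸)‖ ≤ 1 ∧
      ‖((((fun _ : Bond d (towerP L m (n + 1)) => (1 : 𝔸ˣ)) b)⁻¹ : 𝔸ˣ) : 𝔸)‖ ≤ 1 := fun b =>
    ⟨by rw [Units.val_one, norm_one], by rw [inv_one, Units.val_one, norm_one]⟩
  have hD1 : ∀ g : Bond d (towerP L m (n + 1)) → 𝔸, ‖nabla115 η (fun _ : Bond d (towerP L m (n + 1)) => (1 : 𝔸ˣ)) g‖ ≤ (2 * ‖((η : ℂ))⁻¹‖) * ‖g‖ :=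
    fun g => norm_nabla115_le η _ h1b g
  refine ⟨fun f => ?_, fun f => ?_, fun B => ?_⟩
  · exact norm_jetId_le lev₁ (nabla115 η U) (nabla115 η fun _ => 1) (by positivity) (norm_nabla115_sub_flat_le η U hUb hαη hUη) f
  · have e1 : LinearMap.toContinuousLinearMap
            ((jetLinearEquiv (L : ℝ) η lev₀ lev₁ (nabla115 η (fun _ : Bond d (towerP L m (n + 1)) => (1 : 𝔸ˣ)))).symm.toLinearMap ∘ₗ
              (jetLinearEquiv (L : ℝ) η lev₀ lev₁ (nabla115 η U)).toLinearMap)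
            (frakGLatticeCLM (L := (L : ℝ)) (η := η) (lev₀ := lev₀) φ hpos₁ hQU lev₁ (nabla115 η U) f) =
        toCLM115 (L := (L : ℝ)) (η := η) (lev₀ := lev₀) lev₁ (nabla115 η fun _ : Bond d (towerP L m (n + 1)) => (1 : 𝔸ˣ))
          (readFun φ (fun _ => c₀) (fun _ => c₀) (frakGLatticeK hpos₁ hQU)) f :=
      jetId_frakG_eq_toCLM115_readFun (L := (L : ℝ)) (η := η) (lev₀ := lev₀) φ lev₁ (nabla115 η U) (nabla115 η fun _ => 1)
        (G1LatticeK hpos₁) (QkW L m n φ U hL αU hα1 hU1 hreg (c₀ := c₀) (c₁ := c₁)) (KinvLatticeK hpos₁ hQU)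
        (covDerivL2K ℂ c₀ ((η : ℂ))⁻¹ (adTransportW φ U)) (RofUk L m n φ η U)
        (covDivL2K ℂ c₀ ((η : ℂ))⁻¹ (adTransportW φ fun b => (U b)⁻¹)) f
    have e2 : frakGLatticeCLM (L := (L : ℝ)) (η := η) (lev₀ := lev₀) (c := ((η : ℂ))⁻¹) (R := adTransportW φ (fun _ : Bond d (towerP L m (n + 1)) => (1 : 𝔸ˣ)))
              (S := adTransportW φ fun _ : Bond d (towerP L m (n + 1)) => (1 : 𝔸ˣ)⁻¹) (Δ₁ := hessOp φ η (fun _ : Bond d (towerP L m (n + 1)) => (1 : 𝔸ˣ)) τ)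
              (Rr := RofUk L m n φ η (fun _ : Bond d (towerP L m (n + 1)) => (1 : 𝔸ˣ)))
              (Q := (QkW L m n φ (fun _ : Bond d (towerP L m (n + 1)) => (1 : 𝔸ˣ)) hL (fun _ => 0) (fun _ => by norm_num)
                (perCfg_UlevOf_one_mem_U1 L m (n + 1)) (norm_Wcx_UlevOf_one_sub_one_le L m (n + 1) (fun _ => 0) (fun _ => le_rfl)) (c₀ := c₀) (c₁ := c₁)))
              (a := a) φ hpos1 hQ1 lev₁ (nabla115 η fun _ : Bond d (towerP L m (n + 1)) => (1 : 𝔸ˣ)) f =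
        toCLM115 (L := (L : ℝ)) (η := η) (lev₀ := lev₀) lev₁ (nabla115 η fun _ : Bond d (towerP L m (n + 1)) => (1 : 𝔸ˣ))
          (readFun φ (fun _ => c₀) (fun _ => c₀) (frakGLatticeK (c := ((η : ℂ))⁻¹)
            (R := adTransportW φ (fun _ : Bond d (towerP L m (n + 1)) => (1 : 𝔸ˣ))) (S := adTransportW φ fun _ : Bond d (towerP L m (n + 1)) => (1 : 𝔸ˣ)⁻¹)
            (Δ₁ := hessOp φ η (fun _ : Bond d (towerP L m (n + 1)) => (1 : 𝔸ˣ)) τ) (Rr := RofUk L m n φ η (fun _ : Bond d (towerP L m (n + 1)) => (1 : 𝔸ˣ)))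
            (Q := (QkW L m n φ (fun _ : Bond d (towerP L m (n + 1)) => (1 : 𝔸ˣ)) hL (fun _ => 0) (fun _ => by norm_num)
              (perCfg_UlevOf_one_mem_U1 L m (n + 1)) (norm_Wcx_UlevOf_one_sub_one_le L m (n + 1) (fun _ => 0) (fun _ => le_rfl)) (c₀ := c₀) (c₁ := c₁)))
            (a := a) hpos1 hQ1)) f :=
      frakG_eq_toCLM115_readFun (L := (L : ℝ)) (η := η) (lev₀ := lev₀) φ lev₁ (nabla115 η fun _ => 1)
        (G1LatticeK hpos1) (QkW L m n φ (fun _ : Bond d (towerP L m (n + 1)) => (1 : 𝔸ˣ)) hL (fun _ => 0) (fun _ => by norm_num)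
          (perCfg_UlevOf_one_mem_U1 L m (n + 1)) (norm_Wcx_UlevOf_one_sub_one_le L m (n + 1) (fun _ => 0) (fun _ => le_rfl)) (c₀ := c₀) (c₁ := c₁))
        (KinvLatticeK hpos1 hQ1) (covDerivL2K ℂ c₀ ((η : ℂ))⁻¹ (adTransportW φ fun _ => 1)) (RofUk L m n φ η fun _ => 1)
        (covDivL2K ℂ c₀ ((η : ℂ))⁻¹ (adTransportW φ fun b => ((fun _ : Bond d (towerP L m (n + 1)) => (1 : 𝔸ˣ)) b)⁻¹)) f
    rw [e1, e2]
    have h := norm_toCLM115_readFun_sub_le (L := (L : ℝ)) (η := η) (lev₀ := lev₀) φ hMφ hφ hMφ' hφ' lev₁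
      (nabla115 η fun _ : Bond d (towerP L m (n + 1)) => (1 : 𝔸ˣ)) (frakGLatticeK hpos₁ hQU)
      (frakGLatticeK (c := ((η : ℂ))⁻¹)
        (R := adTransportW φ (fun _ : Bond d (towerP L m (n + 1)) => (1 : 𝔸ˣ))) (S := adTransportW φ fun _ : Bond d (towerP L m (n + 1)) => (1 : 𝔸ˣ)⁻¹)
        (Δ₁ := hessOp φ η (fun _ : Bond d (towerP L m (n + 1)) => (1 : 𝔸ˣ)) τ) (Rr := RofUk L m n φ η (fun _ : Bond d (towerP L m (n + 1)) => (1 : 𝔸ˣ)))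
        (Q := (QkW L m n φ (fun _ : Bond d (towerP L m (n + 1)) => (1 : 𝔸ˣ)) hL (fun _ => 0) (fun _ => by norm_num)
          (perCfg_UlevOf_one_mem_U1 L m (n + 1)) (norm_Wcx_UlevOf_one_sub_one_le L m (n + 1) (fun _ => 0) (fun _ => le_rfl)) (c₀ := c₀) (c₁ := c₁)))
        (a := a) hpos1 hQ1) hCα hG hD1 f
    exact le_of_le_of_eq h (by ring)
  · have e1 : LinearMap.toContinuousLinearMap
            ((jetLinearEquiv (L : ℝ) η lev₀ lev₁ (nabla115 η (fun _ : Bond d (towerP L m (n + 1)) => (1 : 𝔸ˣ)))).symm.toLinearMap ∘ₗ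
              (jetLinearEquiv (L : ℝ) η lev₀ lev₁ (nabla115 η U)).toLinearMap)
            (H1LatticeCLM (L := (L : ℝ)) (η := η) (lev₀ := lev₀) (levB := levB) φ hpos₁ hQU lev₁ (nabla115 η U) B) =
        H1CLM (L := (L : ℝ)) (η := η) (lev₀ := lev₀) (levB := levB) φ lev₁ (nabla115 η fun _ : Bond d (towerP L m (n + 1)) => (1 : 𝔸ˣ))
          (H1LatticeK hpos₁ hQU) B := rfl
    have e2 : H1LatticeCLM (L := (L : ℝ)) (η := η) (lev₀ := lev₀) (levB := levB) (c := ((η : ℂ))⁻¹)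
              (R := adTransportW φ (fun _ : Bond d (towerP L m (n + 1)) => (1 : 𝔸ˣ)))
              (S := adTransportW φ fun _ : Bond d (towerP L m (n + 1)) => (1 : 𝔸ˣ)⁻¹) (Δ₁ := hessOp φ η (fun _ : Bond d (towerP L m (n + 1)) => (1 : 𝔸ˣ)) τ)
              (Rr := RofUk L m n φ η (fun _ : Bond d (towerP L m (n + 1)) => (1 : 𝔸ˣ)))
              (Q := (QkW L m n φ (fun _ : Bond d (towerP L m (n + 1)) => (1 : 𝔸ˣ)) hL (fun _ => 0) (fun _ => by norm_num)
                (perCfg_UlevOf_one_mem_U1 L m (n + 1)) (norm_Wcx_UlevOf_one_sub_one_le L m (n + 1) (fun _ => 0) (fun _ => le_rfl)) (c₀ := c₀) (c₁ := c₁)))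
              (a := a) φ hpos1 hQ1 lev₁ (nabla115 η fun _ : Bond d (towerP L m (n + 1)) => (1 : 𝔸ˣ)) B =
        H1CLM (L := (L : ℝ)) (η := η) (lev₀ := lev₀) (levB := levB) φ lev₁ (nabla115 η fun _ : Bond d (towerP L m (n + 1)) => (1 : 𝔸ˣ))
          (H1LatticeK (c := ((η : ℂ))⁻¹)
            (R := adTransportW φ (fun _ : Bond d (towerP L m (n + 1)) => (1 : 𝔸ˣ))) (S := adTransportW φ fun _ : Bond d (towerP L m (n + 1)) => (1 : 𝔸ˣ)⁻¹)
            (Δ₁ := hessOp φ η (fun _ : Bond d (towerP L m (n + 1)) => (1 : 𝔸ˣ)) τ) (Rr := RofUk L m n φ η (fun _ : Bond d (towerP L m (n + 1)) => (1 : 𝔸ˣ)))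
            (Q := (QkW L m n φ (fun _ : Bond d (towerP L m (n + 1)) => (1 : 𝔸ˣ)) hL (fun _ => 0) (fun _ => by norm_num)
              (perCfg_UlevOf_one_mem_U1 L m (n + 1)) (norm_Wcx_UlevOf_one_sub_one_le L m (n + 1) (fun _ => 0) (fun _ => le_rfl)) (c₀ := c₀) (c₁ := c₁)))
            (a := a) hpos1 hQ1) B := rfl
    rw [e1, e2]
    have h := norm_H1CLM_sub_le (L := (L : ℝ)) (η := η) (lev₀ := lev₀) (levB := levB) φ hMφ hφ hMφ' hφ' lev₁
      (nabla115 η fun _ : Bond d (towerP L m (n + 1)) => (1 : 𝔸ˣ)) (H1LatticeK hpos₁ hQU)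
      (H1LatticeK (c := ((η : ℂ))⁻¹)
        (R := adTransportW φ (fun _ : Bond d (towerP L m (n + 1)) => (1 : 𝔸ˣ))) (S := adTransportW φ fun _ : Bond d (towerP L m (n + 1)) => (1 : 𝔸ˣ)⁻¹)
        (Δ₁ := hessOp φ η (fun _ : Bond d (towerP L m (n + 1)) => (1 : 𝔸ˣ)) τ) (Rr := RofUk L m n φ η (fun _ : Bond d (towerP L m (n + 1)) => (1 : 𝔸ˣ)))
        (Q := (QkW L m n φ (fun _ : Bond d (towerP L m (n + 1)) => (1 : 𝔸ˣ)) hL (fun _ => 0) (fun _ => by norm_num)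
          (perCfg_UlevOf_one_mem_U1 L m (n + 1)) (norm_Wcx_UlevOf_one_sub_one_le L m (n + 1) (fun _ => 0) (fun _ => le_rfl)) (c₀ := c₀) (c₁ := c₁)))
        (a := a) hpos1 hQ1) hCα hH hD1 B
    exact le_of_le_of_eq h (by ring)

end Literature.MathematicalPhysics.QuantumFieldTheory.Balaban1983to89.B11Eq117LetterDefectsTowerPiDiagonal

end
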